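import Literature.Probability.RandomPlanarGeometry.ChordalCurveFamilyProofs
import Literature.Probability.RandomPlanarGeometry.LatticeSimilarityCovariance

/-!
# Curve classes, curve surgery and marked domains under complex conjugation (transport lemmas)

By-product of the cdisprove unit on crux `CardyRotToConfR2SymmetryUpgrade`
(stmt-CriticalPhenomena-0698), part 1 of 2 (part 2: `ConjTransport.lean`, the reflection symmetry
of the typed hypothesis bundle `IsLocalMarkovChordalFamily` + non-tracing, and the chirality
refutation template).

Genuine lemmas, for the conjugation homeomorphism `Complex.conjLIE.toHomeomorph : ℂ ≃ₜ ℂ`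
already used by `LatticeSimilarityCovariance.lean` (also coerced to `C(ℂ, ℂ)`):
* `measurableEmbedding_curveClassMap_conj` — push-forward of curve classes along `conj` is an
  involutive MEASURABLE EMBEDDING, so push-forward laws can be evaluated on ARBITRARY sets
  (`MeasurableEmbedding.map_apply`), e.g. on `CurveClass.stopAt F ⁻¹' T` whose measurability is
  not in the tree;
* `curve_stopAt_map`, `curve_startFrom_map`, `curveClass_stopAt_map`, `curveClass_startFrom_map` —
  the curve surgery of `ChordalCurveFamily.lean` commutes with push-forward along any continuous
  map (closed `F` at class level, via `CurveClass.stopAt_mk_holds` / `startFrom_mk_holds`);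
* `markedDomain_map_conj_map_conj`, `markedDomain_chord_map`, `similarity_trans_conj`;
* `remainingDomain_map` — the remaining domain of `ChordalCurveFamily.lean` is transported by any
  plane homeomorphism (`Homeomorph.image_connectedComponentIn`, `Homeomorph.image_closure`).
-/

noncomputable section

open Set MeasureTheory Topology Filter
open scoped unitInterval ENNReal NNReal ComplexConjugate

namespace Summit.CriticalPhenomena.CardyFormulaZ2.Theorems.CardyRotToConfR2SymmetryUpgrade.Negative

open Literature.Probability.RandomPlanarGeometry
open Literature.Probability.RandomPlanarGeometry.ChordalFamily
open Complex (conjLIE conj_conj)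

/-! ### Conjugation on points, sets, curves and curve classes -/

/-- `conj ∘ conj = id` as homeomorphisms. [folklore] -/
theorem conjH_trans_conjH :
    conjLIE.toHomeomorph.trans conjLIE.toHomeomorph = Homeomorph.refl ℂ :=
  Homeomorph.ext conj_conj

/-- Preimages under the involution `conj` are images. [folklore] -/
theorem conjH_preimage (A : Set ℂ) :
    conjLIE.toHomeomorph ⁻¹' A = conjLIE.toHomeomorph '' A := by
  ext z
  constructor
  · intro hz
    exact ⟨conjLIE.toHomeomorph z, hz, conj_conj z⟩
  · rintro ⟨w, hw, rfl⟩
    show conjLIE.toHomeomorph (conjLIE.toHomeomorph w) ∈ A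
    rwa [conjLIE_toHomeomorph_apply, conjLIE_toHomeomorph_apply, conj_conj]

/-- Double image under `conj` is the identity on sets. [folklore] -/
theorem conjH_image_image (A : Set ℂ) :
    conjLIE.toHomeomorph '' (conjLIE.toHomeomorph '' A) = A := by
  rw [← conjH_preimage, ← conjH_preimage]
  ext z
  simp only [Set.mem_preimage, conjLIE_toHomeomorph_apply, conj_conj]

/-- Conjugating a curve twice gives it back. [folklore] -/
theorem curve_map_conj_map_conj (γ : Curve ℂ) :
    (γ.map (conjLIE.toHomeomorph : C(ℂ, ℂ))).map (conjLIE.toHomeomorph : C(ℂ, ℂ)) = γ :=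
  Curve.ext (ContinuousMap.ext fun t => by simp [conjLIE_toHomeomorph_apply])

/-- Conjugating a curve class twice gives it back. [folklore] -/
theorem curveClassMap_conj_conj (c : CurveClass ℂ) :
    CurveClass.map (conjLIE.toHomeomorph : C(ℂ, ℂ))
      (CurveClass.map (conjLIE.toHomeomorph : C(ℂ, ℂ)) c) = c := by
  obtain ⟨γ, rfl⟩ := CurveClass.surjective_mk c
  rw [CurveClass.map_mk, CurveClass.map_mk, curve_map_conj_map_conj]

/-- Preimages under the involution `conj_*` are images. [folklore] -/
theorem curveClassMap_conj_preimage (A : Set (CurveClass ℂ)) :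
    CurveClass.map (conjLIE.toHomeomorph : C(ℂ, ℂ)) ⁻¹' A =
      CurveClass.map (conjLIE.toHomeomorph : C(ℂ, ℂ)) '' A := by
  ext c
  constructor
  · intro hc
    exact ⟨_, hc, curveClassMap_conj_conj c⟩
  · rintro ⟨w, hw, rfl⟩
    show CurveClass.map (conjLIE.toHomeomorph : C(ℂ, ℂ))
      (CurveClass.map (conjLIE.toHomeomorph : C(ℂ, ℂ)) w) ∈ A
    rwa [curveClassMap_conj_conj]

/-- **Push-forward of curve classes along `conj` is a measurable embedding** (involutive and
Borel), so `(μ.map conj_*) s = μ (conj_* ⁻¹' s)` for EVERY set `s`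
(`MeasurableEmbedding.map_apply`). [folklore] -/
theorem measurableEmbedding_curveClassMap_conj :
    MeasurableEmbedding (CurveClass.map (conjLIE.toHomeomorph : C(ℂ, ℂ))) where
  injective := Function.LeftInverse.injective curveClassMap_conj_conj
  measurable := measurable_curveClassMap_conj
  measurableSet_image' := fun s hs => by
    rw [← curveClassMap_conj_preimage]
    exact hs.preimage measurable_curveClassMap_conj

/-! ### Curve surgery commutes with push-forward along a continuous map -/

/-- The hitting parameter of `F` by `f ∘ γ` is that of `f ⁻¹ F` by `γ`. [folklore] -/
theorem curve_hitParam_map (f : C(ℂ, ℂ)) (F : Set ℂ) (γ : Curve ℂ) :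
    (γ.map f).hitParam F = γ.hitParam (f ⁻¹' F) := rfl

/-- Initial segments commute with push-forward along a continuous map. [folklore] -/
theorem curve_stopAt_map (f : C(ℂ, ℂ)) (F : Set ℂ) (γ : Curve ℂ) :
    (γ.map f).stopAt F = (γ.stopAt (f ⁻¹' F)).map f :=
  Curve.ext (ContinuousMap.ext fun s => by
    change ((γ.map f).stopAt F) s = ((γ.stopAt (f ⁻¹' F)).map f) s
    rw [Curve.stopAt_apply, Curve.map_apply, Curve.map_apply, Curve.stopAt_apply,
      curve_hitParam_map])

/-- Final segments commute with push-forward along a continuous map. [folklore] -/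
theorem curve_startFrom_map (f : C(ℂ, ℂ)) (F : Set ℂ) (γ : Curve ℂ) :
    (γ.map f).startFrom F = (γ.startFrom (f ⁻¹' F)).map f :=
  Curve.ext (ContinuousMap.ext fun s => by
    change ((γ.map f).startFrom F) s = ((γ.startFrom (f ⁻¹' F)).map f) s
    rw [Curve.startFrom_apply, Curve.map_apply, Curve.map_apply, Curve.startFrom_apply,
      curve_hitParam_map])

/-- For closed `F`: stopping the image class on `F` = image of the class stopped on `f ⁻¹ F`.
[folklore] -/
theorem curveClass_stopAt_map (f : C(ℂ, ℂ)) {F : Set ℂ} (hF : IsClosed F)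
    (c : CurveClass ℂ) :
    CurveClass.stopAt F (CurveClass.map f c) =
      CurveClass.map f (CurveClass.stopAt (f ⁻¹' F) c) := by
  obtain ⟨γ, rfl⟩ := CurveClass.surjective_mk c
  rw [CurveClass.map_mk, CurveClass.stopAt_mk_holds F hF,
    CurveClass.stopAt_mk_holds _ (hF.preimage f.continuous), CurveClass.map_mk,
    curve_stopAt_map]

/-- For closed `F`: the final segment of the image class from `F` = image of the final segment
from `f ⁻¹ F`. [folklore] -/
theorem curveClass_startFrom_map (f : C(ℂ, ℂ)) {F : Set ℂ} (hF : IsClosed F)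
    (c : CurveClass ℂ) :
    CurveClass.startFrom F (CurveClass.map f c) =
      CurveClass.map f (CurveClass.startFrom (f ⁻¹' F) c) := by
  obtain ⟨γ, rfl⟩ := CurveClass.surjective_mk c
  rw [CurveClass.map_mk, CurveClass.startFrom_mk_holds F hF,
    CurveClass.startFrom_mk_holds _ (hF.preimage f.continuous), CurveClass.map_mk,
    curve_startFrom_map]

/-- Preimage of a stopped-curve event under `conj_*` (closed `F`). [folklore] -/
theorem curveClassMap_conj_preimage_stopAt {F : Set ℂ} (hF : IsClosed F)
    (T : Set (CurveClass ℂ)) :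
    CurveClass.map (conjLIE.toHomeomorph : C(ℂ, ℂ)) ⁻¹' (CurveClass.stopAt F ⁻¹' T) =
      CurveClass.stopAt (conjLIE.toHomeomorph ⁻¹' F) ⁻¹'
        (CurveClass.map (conjLIE.toHomeomorph : C(ℂ, ℂ)) ⁻¹' T) := by
  ext c
  simp only [Set.mem_preimage, curveClass_stopAt_map _ hF]
  rfl

/-- Preimage of a final-segment event under `conj_*` (closed `F`). [folklore] -/
theorem curveClassMap_conj_preimage_startFrom {F : Set ℂ} (hF : IsClosed F)
    (T : Set (CurveClass ℂ)) :
    CurveClass.map (conjLIE.toHomeomorph : C(ℂ, ℂ)) ⁻¹' (CurveClass.startFrom F ⁻¹' T) =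
      CurveClass.startFrom (conjLIE.toHomeomorph ⁻¹' F) ⁻¹'
        (CurveClass.map (conjLIE.toHomeomorph : C(ℂ, ℂ)) ⁻¹' T) := by
  ext c
  simp only [Set.mem_preimage, curveClass_startFrom_map _ hF]
  rfl

/-! ### Marked domains under conjugation -/

/-- Conjugating a marked domain twice gives it back. [folklore] -/
theorem markedDomain_map_conj_map_conj {n : ℕ} (D : MarkedDomain n) :
    (D.map conjLIE.toHomeomorph).map conjLIE.toHomeomorph = D := by
  rw [MarkedDomain.map_map, conjH_trans_conjH]
  exact MarkedDomain.ext (JordanDomain.ext (by simp) rfl) rfl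

/-- Taking a chord commutes with the image under a homeomorphism (definitionally). [folklore] -/
theorem markedDomain_chord_map {n : ℕ} (D : MarkedDomain n) (φ : ℂ ≃ₜ ℂ) (i j : Fin n)
    (h : i < j) : (D.map φ).chord i j h = (D.chord i j h).map φ := rfl

/-- The similarity `z ↦ cz + w` conjugated by `conj` is the similarity `z ↦ c̄z + w̄`.
[folklore] -/
theorem similarity_trans_conj (c : ℂ) (hc : c ≠ 0) (w : ℂ) :
    (similarity c hc w).trans conjLIE.toHomeomorph =
      conjLIE.toHomeomorph.trans
        (similarity (conj c) ((map_ne_zero_iff _ (RingHom.injective _)).2 hc) (conj w)) :=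
  Homeomorph.ext fun z => by simp [conjLIE_toHomeomorph_apply]

/-- The remaining domain (`ChordalCurveFamily.remainingDomain`) is transported by a plane
homeomorphism. [folklore] -/
theorem remainingDomain_map (D : DobrushinDomain) (φ : ℂ ≃ₜ ℂ) (p : CurveClass ℂ) :
    remainingDomain (D.map φ) (CurveClass.map (φ : C(ℂ, ℂ)) p) =
      φ '' remainingDomain D p := by
  have hdiff : (D.map φ).carrier \ (CurveClass.map (φ : C(ℂ, ℂ)) p).range =
      φ '' (D.carrier \ p.range) := by
    rw [MarkedDomain.carrier_map, CurveClass.range_map, Set.image_sdiff φ.injective]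
    rfl
  ext z
  simp only [remainingDomain, Set.mem_setOf_eq, hdiff, MarkedDomain.pt_map]
  constructor
  · rintro ⟨⟨w, hw, rfl⟩, hb⟩
    refine ⟨w, ⟨hw, ?_⟩, rfl⟩
    rw [← φ.image_connectedComponentIn hw, ← φ.image_closure] at hb
    exact (φ.injective.mem_set_image).1 hb
  · rintro ⟨w, ⟨hw, hb⟩, rfl⟩
    refine ⟨⟨w, hw, rfl⟩, ?_⟩
    rw [← φ.image_connectedComponentIn hw, ← φ.image_closure]
    exact Set.mem_image_of_mem _ hb

end Summit.CriticalPhenomena.CardyFormulaZ2.Theorems.CardyRotToConfR2SymmetryUpgrade.Negative
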